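import Summits.ValiantsHypothesis.ValiantsHypothesis.Theses.UlrichPadded
import Summits.ValiantsHypothesis.ValiantsHypothesis.Theorems.UlrichPaddedRankOneTrivialisationNegativeLoadBearing
import Summits.ValiantsHypothesis.ValiantsHypothesis.Theorems.UlrichPaddedRankOneTrivialisationDegreeBudget
import Literature.RingTheory.MvPolynomial.KaltofenBoundsMatrixTools
import Literature.Computability.AlgebraicComplexity.StandardFamiliesProofs
import Literature.Computability.AlgebraicComplexity.RankOneDeterminantalExpressionsProofs
import Literature.Computability.AlgebraicComplexity.PermanentIrreducible

/-!
# `UlrichPadded.RankOneTrivialisation` (stmt-ValiantsHypothesis-5667): the degree budget carries no load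

Negative knowledge for the crux (standing disprover, cycle 2, 2026-08-16).  The crux asks, for every
affine determinantal representation `A` of `per_n` (`n ≥ 3`, size `m`), for `adj A ≡ c wᵀ (mod per_n)`
WITH the degree budget `deg c + deg w ≤ m - 1`.  The budget is automatic — the generic engine
`outerProduct_degree_trim` (any field, any homogeneous prime form; written in the crux work file
`Cruxes/RankOneTrivialisation/Disproof.lean` §DegreeBudget and LANDED as
`Theorems/UlrichPaddedRankOneTrivialisationDegreeBudget.lean`, imported here) re-chooses any
factorisation modulo `per_n` within the budget — so a counterexample to the crux would have to fail to
factor modulo `per_n` AT ALL.  This file records the `per_n` form of the engine and maps the `n = 2`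
edge in that degree-free form:

* `outerProduct_degree_automatic`, `adjugate_outerProduct_degree_automatic` — the `per_n`
  specialisations (`perPoly_irreducible`, `perPoly_isHomogeneous`; cofactor degrees `≤ m - 1` from
  `Literature.RingTheory.MvPolynomial.KaltofenBounds.totalDegree_adjugate_le`).
* `A₂_adjugate_not_outerProduct`, `rankOneTrivialisationDegreeFree_false_from_two` — at `n = 2`
  (`A₂ = [[x₀₀, -x₀₁], [x₁₀, x₁₁]]`, the quadric cone, `Cl = ℤ`) the adjugate is not an outer product
  modulo `per₂` even without any degree bound (sharpening `rankOneTrivialisation_false_at_two` of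
  `UlrichPaddedRankOneTrivialisationNegativeLoadBearing.lean`, whose degree-bounded computation is
  isolated as `A₂_no_bounded_factorisation`): the kernel module of `A₂` is the ruling of the cone, not
  invertible at the vertex — von zur Gathen's corank-one input is what fails below `n = 3`, and
  `3 ≤ n` stays load-bearing after the degree budget is deleted.

All statements are inline (no new named facts, no definitions: the witness matrix is written out
literally); helper lemmas are folklore.
-/

noncomputable section

namespace Summit.ValiantsHypothesis.Theorems.RankOneTrivialisationNegative.DegreeFree

open MvPolynomial Matrix
open Literature.Computability.AlgebraicComplexity
open Summit.ValiantsHypothesis.Theorems.RankOneTrivialisationNegative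
open Summit.ValiantsHypothesis.Theorems.RankOneTrivialisation (outerProduct_degree_trim)

/-! ## The engine specialised to `per_n` over `ℂ` -/

/-- **Degree bookkeeping is automatic (per_n form).** If a matrix `B` with entries of degree `≤ D`
factors as an outer product modulo `per_n` AT ALL (`n ≥ 1`), then it does so with `deg c + deg w ≤ D`
(tree engine `outerProduct_degree_trim` with `f = per_n`, prime by `perPoly_irreducible` and
homogeneous by `perPoly_isHomogeneous`). [folklore] -/
theorem outerProduct_degree_automatic {n m D : ℕ} (hn : 1 ≤ n)
    (B : Matrix (Fin m) (Fin m) (MvPolynomial (Fin n × Fin n) ℂ)) (hB : ∀ i j, (B i j).totalDegree ≤ D)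
    (c w : Fin m → MvPolynomial (Fin n × Fin n) ℂ)
    (h : ∀ i j, B i j - c i * w j ∈ Ideal.span {perPoly (Fin n) ℂ}) :
    ∃ (c' w' : Fin m → MvPolynomial (Fin n × Fin n) ℂ) (dc dw : ℕ), dc + dw ≤ D ∧
      (∀ i, (c' i).totalDegree ≤ dc) ∧ (∀ i, (w' i).totalDegree ≤ dw) ∧
      ∀ i j, B i j - c' i * w' j ∈ Ideal.span {perPoly (Fin n) ℂ} :=
  haveI : Nonempty (Fin n) := ⟨⟨0, hn⟩⟩
  outerProduct_degree_trim
    (by simpa [Fintype.card_fin] using perPoly_isHomogeneous (n := Fin n) (k := ℂ))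
    (UniqueFactorizationMonoid.irreducible_iff_prime.mp perPoly_irreducible) B hB c w h

/-- **The crux's own budget `m - 1` is automatic**: for an `m × m` matrix `A` of affine polynomials
(`n ≥ 1`), any factorisation `adj A ≡ c wᵀ (mod per_n)` can be re-chosen with `deg c + deg w ≤ m - 1`
(cofactors of an affine matrix have degree `≤ m - 1`, tree `KaltofenBounds.totalDegree_adjugate_le`).
So `RankOneTrivialisation` is equivalent to its degree-free form. [folklore] -/
theorem adjugate_outerProduct_degree_automatic {n m : ℕ} (hn : 1 ≤ n)
    (A : Matrix (Fin m) (Fin m) (MvPolynomial (Fin n × Fin n) ℂ)) (hA : ∀ i j, (A i j).totalDegree ≤ 1)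
    (c w : Fin m → MvPolynomial (Fin n × Fin n) ℂ)
    (h : ∀ i j, A.adjugate i j - c i * w j ∈ Ideal.span {perPoly (Fin n) ℂ}) :
    ∃ (c' w' : Fin m → MvPolynomial (Fin n × Fin n) ℂ) (dc dw : ℕ), dc + dw ≤ m - 1 ∧
      (∀ i, (c' i).totalDegree ≤ dc) ∧ (∀ i, (w' i).totalDegree ≤ dw) ∧
      ∀ i j, A.adjugate i j - c' i * w' j ∈ Ideal.span {perPoly (Fin n) ℂ} :=
  outerProduct_degree_automatic hn A.adjugate
    (fun i j => by
      simpa [Fintype.card_fin] using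
        Literature.RingTheory.MvPolynomial.KaltofenBounds.totalDegree_adjugate_le A 1 hA i j)
    c w h

/-! ## The `n = 2` edge, degree-free -/

/-- The computation behind `rankOneTrivialisation_false_at_two`: `adj A₂ = [[x₁₁, x₀₁],
[-x₁₀, x₀₀]]` is not `≡ c wᵀ (mod per₂)` with `deg c + deg w ≤ 1` — one factor would be constant,
forcing two linearly independent linear forms to be proportional modulo the quadric. (`A₂_adjugate_not_outerProduct` below removes the
degree bound.) [folklore] -/
theorem A₂_no_bounded_factorisation (c w : Fin 2 → MvPolynomial (Fin 2 × Fin 2) ℂ) (dc dw : ℕ)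
    (hsum : dc + dw ≤ 1) (hc : ∀ i, (c i).totalDegree ≤ dc) (hw : ∀ i, (w i).totalDegree ≤ dw)
    (hmem : ∀ i j, (!![X (0, 0), -X (0, 1); X (1, 0), X (1, 1)] :
        Matrix (Fin 2) (Fin 2) (MvPolynomial (Fin 2 × Fin 2) ℂ)).adjugate i j - c i * w j ∈
      Ideal.span {perPoly (Fin 2) ℂ}) : False := by
  have hadj : (!![X (0, 0), -X (0, 1); X (1, 0), X (1, 1)] :
        Matrix (Fin 2) (Fin 2) (MvPolynomial (Fin 2 × Fin 2) ℂ)).adjugate =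
      !![X (1, 1), X (0, 1); -X (1, 0), X (0, 0)] := by
    rw [Matrix.adjugate_fin_two]
    simp
  have low : ∀ q : MvPolynomial (Fin 2 × Fin 2) ℂ, q ∈ Ideal.span {perPoly (Fin 2) ℂ} →
      q.totalDegree < 2 → q = 0 := fun q hq hd => eq_zero_of_mem_span_perPoly hq hd
  have h00 := hmem 0 0
  have h10 := hmem 1 0
  have h01 := hmem 0 1
  simp only [hadj, Matrix.of_apply, Matrix.cons_val', Matrix.cons_val_zero, Matrix.cons_val_one,
    Matrix.empty_val', Matrix.cons_val_fin_one] at h00 h10 h01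
  have hdeg1 : ∀ (a b : ℂ) (u v : Fin 2 × Fin 2),
      (C b * X u + C a * X v : MvPolynomial (Fin 2 × Fin 2) ℂ).totalDegree < 2 := by
    intro a b u v
    refine lt_of_le_of_lt ((totalDegree_add _ _).trans (max_le ?_ ?_)) one_lt_two <;>
      exact (totalDegree_mul _ _).trans (by simp [totalDegree_X])
  rcases (show dc = 0 ∨ dw = 0 by omega) with hdc | hdw
  · -- `c` is a vector of constants
    subst hdc
    have hc0 : c 0 = C (coeff 0 (c 0)) := totalDegree_eq_zero_iff_eq_C.1 (Nat.le_zero.1 (hc 0))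
    have hc1 : c 1 = C (coeff 0 (c 1)) := totalDegree_eq_zero_iff_eq_C.1 (Nat.le_zero.1 (hc 1))
    set a := coeff 0 (c 0)
    set b := coeff 0 (c 1)
    have hq : (C b * X (1, 1) + C a * X (1, 0) : MvPolynomial (Fin 2 × Fin 2) ℂ) ∈
        Ideal.span {perPoly (Fin 2) ℂ} := by
      have := Ideal.sub_mem _ (Ideal.mul_mem_left _ (C b) h00) (Ideal.mul_mem_left _ (C a) h10)
      convert this using 1
      rw [hc0, hc1]
      ring
    have hq0 := low _ hq (hdeg1 a b _ _)
    have hb : b = 0 := by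
      simpa using congr_arg (eval fun ij : Fin 2 × Fin 2 => if ij = (1, 1) then (1 : ℂ) else 0) hq0
    have ha : a = 0 := by
      simpa using congr_arg (eval fun ij : Fin 2 × Fin 2 => if ij = (1, 0) then (1 : ℂ) else 0) hq0
    have hX : (X (1, 1) : MvPolynomial (Fin 2 × Fin 2) ℂ) ∈ Ideal.span {perPoly (Fin 2) ℂ} := by
      have := h00
      rw [hc0, ha] at this
      simpa using this
    exact X_notMem_span_perPoly le_rfl _ hX
  · -- `w` is a vector of constants
    subst hdw
    have hw0 : w 0 = C (coeff 0 (w 0)) := totalDegree_eq_zero_iff_eq_C.1 (Nat.le_zero.1 (hw 0))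
    have hw1 : w 1 = C (coeff 0 (w 1)) := totalDegree_eq_zero_iff_eq_C.1 (Nat.le_zero.1 (hw 1))
    set a := coeff 0 (w 0)
    set b := coeff 0 (w 1)
    have hq : (C b * X (1, 1) + C (-a) * X (0, 1) : MvPolynomial (Fin 2 × Fin 2) ℂ) ∈
        Ideal.span {perPoly (Fin 2) ℂ} := by
      have := Ideal.sub_mem _ (Ideal.mul_mem_left _ (C b) h00) (Ideal.mul_mem_left _ (C a) h01)
      convert this using 1
      rw [hw0, hw1, C_neg]
      ring
    have hq0 := low _ hq (hdeg1 (-a) b _ _)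
    have hb : b = 0 := by
      simpa using congr_arg (eval fun ij : Fin 2 × Fin 2 => if ij = (1, 1) then (1 : ℂ) else 0) hq0
    have ha : a = 0 := by
      simpa using congr_arg (eval fun ij : Fin 2 × Fin 2 => if ij = (0, 1) then (1 : ℂ) else 0) hq0
    have hX : (X (1, 1) : MvPolynomial (Fin 2 × Fin 2) ℂ) ∈ Ideal.span {perPoly (Fin 2) ℂ} := by
      have := h00
      rw [hw0, ha] at this
      simpa using this
    exact X_notMem_span_perPoly le_rfl _ hX

/-- **At `n = 2` the failure is not a degree artefact.** `adj A₂` is not an outer product modulo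
`per₂` AT ALL (any factorisation could be trimmed to `deg c + deg w ≤ 1` by
`adjugate_outerProduct_degree_automatic`, which only needs `n ≥ 1`). [folklore] -/
theorem A₂_adjugate_not_outerProduct :
    ¬ ∃ (c w : Fin 2 → MvPolynomial (Fin 2 × Fin 2) ℂ),
      ∀ i j, (!![X (0, 0), -X (0, 1); X (1, 0), X (1, 1)] :
        Matrix (Fin 2) (Fin 2) (MvPolynomial (Fin 2 × Fin 2) ℂ)).adjugate i j -
        c i * w j ∈ Ideal.span {perPoly (Fin 2) ℂ} := by
  rintro ⟨c, w, h⟩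
  have hA : ∀ i j, ((!![X (0, 0), -X (0, 1); X (1, 0), X (1, 1)] :
        Matrix (Fin 2) (Fin 2) (MvPolynomial (Fin 2 × Fin 2) ℂ)) i j).totalDegree ≤ 1 := by
    intro i j
    fin_cases i <;> fin_cases j <;> simp [totalDegree_X, totalDegree_neg]
  obtain ⟨c', w', dc, dw, hsum, hc, hw, hmem⟩ :=
    adjugate_outerProduct_degree_automatic (n := 2) one_le_two _ hA c w h
  exact A₂_no_bounded_factorisation c' w' dc dw hsum hc hw hmem

/-- **The degree-free crux with `3 ≤ n` weakened to `2 ≤ n` is false** (witness `n = m = 2`, `A₂`):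
`3 ≤ n` stays load-bearing after the degree budget is deleted. [folklore] -/
theorem rankOneTrivialisationDegreeFree_false_from_two :
    ¬ ∀ n : ℕ, 2 ≤ n → ∀ (m : ℕ) (A : Matrix (Fin m) (Fin m) (MvPolynomial (Fin n × Fin n) ℂ)),
      IsAffineDetRepr (perPoly (Fin n) ℂ) A →
      ∃ (c w : Fin m → MvPolynomial (Fin n × Fin n) ℂ),
        ∀ i j, A.adjugate i j - c i * w j ∈ Ideal.span {perPoly (Fin n) ℂ} := by
  intro h
  have hrepr : IsAffineDetRepr (perPoly (Fin 2) ℂ) (!![X (0, 0), -X (0, 1); X (1, 0), X (1, 1)] :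
        Matrix (Fin 2) (Fin 2) (MvPolynomial (Fin 2 × Fin 2) ℂ)) := by
    refine ⟨fun i j => ?_, ?_⟩
    · fin_cases i <;> fin_cases j <;> simp [totalDegree_X, totalDegree_neg]
    · have hper2 : perPoly (Fin 2) ℂ = X (0, 0) * X (1, 1) + X (1, 0) * X (0, 1) := by
        simp [perPoly, permanent_fin_two, Matrix.mvPolynomialX_apply]
      rw [Matrix.det_fin_two, hper2]
      simp
      ring
  exact A₂_adjugate_not_outerProduct (h 2 le_rfl 2 _ hrepr)

end Summit.ValiantsHypothesis.Theorems.RankOneTrivialisationNegative.DegreeFree
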